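import Mathlib.Analysis.Calculus.Deriv.MeanValue
import Mathlib.Analysis.Calculus.LocalExtr.Basic
import HarnessLib

/-!
# Crux `HawkingExtensionIsKerr` (stmt-FinalStateConjecture-17840), line `SketchIdeator2` —
# programme NH (near-horizon sign analysis): the one-variable one-sided Taylor lemma

Registered sub-goal `stub_nh_oneSidedTaylor` of the line lead's skeleton.  Along an integral curve
`γ` of a transverse field through a point of a DEGENERATE Killing horizon, `φ = g(K,K) ∘ γ` has
`φ 0 = 0`, `φ' 0 = 0`, and `φ ≤ 0` wherever `ψ = F ∘ γ < 0` (`F` a local defining function of the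
horizon with `ψ' 0 ≠ 0`).  THE LEMMA: then the second derivative `a = φ'' 0` is `≤ 0`.

PROOF.  If `a > 0` then, since `φ' 0 = 0` and `φ'` has derivative `a` at `0`, the difference
quotient `φ' t / t → a > 0`, so `φ' t` has the sign of `t` on a punctured interval about `0`; by
Lagrange's mean value theorem `φ t = t · φ' c > 0` (`c` strictly between `0` and `t`) for every
small `t ≠ 0`.  Hence wherever `ψ t < 0` near `0` we would get `φ t ≤ 0 < φ t` unless `t = 0`,
which is excluded by `ψ 0 = 0`; so `ψ ≥ 0 = ψ 0` near `0`, i.e. `0` is a local minimum of `ψ`, and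
Fermat's theorem gives `ψ' 0 = 0`, contradicting `ψ' 0 ≠ 0`.  Pure Mathlib one-variable calculus
(`exists_hasDerivAt_eq_slope`, `hasDerivAt_iff_tendsto_slope`, `IsLocalMin.deriv_eq_zero`).
-/

noncomputable section

set_option linter.dupNamespace false

namespace Summit.FinalStateConjecture.FinalStateConjecture.Theorems.HawkingExtensionIsKerr.SketchIdeator2

open Set Filter Topology

/-- MVT step: if `φ 0 = 0`, `φ` has derivative `φ' s` at every `s ∈ (-δ, δ)`, and `φ' s / s > 0`
for every `s ≠ 0` there, then `φ t > 0` for every `t ≠ 0` in `(-δ, δ)`. -/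
theorem pos_of_hasDerivAt_of_div_pos {φ φ' : ℝ → ℝ} {δ : ℝ}
    (hd : ∀ s ∈ Ioo (-δ) δ, HasDerivAt φ (φ' s) s)
    (hs : ∀ s ∈ Ioo (-δ) δ, s ≠ 0 → 0 < φ' s / s)
    (h0 : φ 0 = 0) {t : ℝ} (ht : t ∈ Ioo (-δ) δ) (ht0 : t ≠ 0) : 0 < φ t := by
  rcases lt_or_gt_of_ne ht0 with hneg | hpos
  · -- `t < 0`: mean value theorem on `[t, 0]`
    have hcont : ContinuousOn φ (Icc t 0) := fun x hx =>
      (hd x ⟨lt_of_lt_of_le ht.1 hx.1, by linarith [ht.1, hx.2]⟩).continuousAt.continuousWithinAt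
    have hder : ∀ x ∈ Ioo t 0, HasDerivAt φ (φ' x) x := fun x hx =>
      hd x ⟨lt_trans ht.1 hx.1, by linarith [ht.1, hx.1, hx.2]⟩
    obtain ⟨c, hc, hceq⟩ := exists_hasDerivAt_eq_slope φ φ' hneg hcont hder
    have hcs := hs c ⟨lt_trans ht.1 hc.1, by linarith [ht.1, hc.1, hc.2]⟩ (ne_of_lt hc.2)
    have hφ'c : φ' c < 0 := by
      rcases div_pos_iff.mp hcs with ⟨_, hc0⟩ | ⟨h, _⟩
      · exact absurd hc0 (not_lt.mpr (le_of_lt hc.2))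
      · exact h
    rw [h0, zero_sub, zero_sub, neg_div_neg_eq] at hceq
    rw [hceq] at hφ'c
    rcases div_neg_iff.mp hφ'c with ⟨h, _⟩ | ⟨_, h⟩
    · exact h
    · exact absurd h (not_lt.mpr (le_of_lt hneg))
  · -- `0 < t`: mean value theorem on `[0, t]`
    have hcont : ContinuousOn φ (Icc 0 t) := fun x hx =>
      (hd x ⟨by linarith [ht.2, hx.1], lt_of_le_of_lt hx.2 ht.2⟩).continuousAt.continuousWithinAt
    have hder : ∀ x ∈ Ioo 0 t, HasDerivAt φ (φ' x) x := fun x hx =>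
      hd x ⟨by linarith [ht.2, hx.1, hx.2], lt_trans hx.2 ht.2⟩
    obtain ⟨c, hc, hceq⟩ := exists_hasDerivAt_eq_slope φ φ' hpos hcont hder
    have hcs := hs c ⟨by linarith [ht.2, hc.1, hc.2], lt_trans hc.2 ht.2⟩ (ne_of_gt hc.1)
    have hφ'c : 0 < φ' c := by
      rcases div_pos_iff.mp hcs with ⟨h, _⟩ | ⟨_, hc0⟩
      · exact h
      · exact absurd hc0 (not_lt.mpr (le_of_lt hc.1))
    rw [h0, sub_zero, sub_zero] at hceq
    rw [hceq] at hφ'c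
    rcases div_pos_iff.mp hφ'c with ⟨h, _⟩ | ⟨_, h⟩
    · exact h
    · exact absurd h (not_lt.mpr (le_of_lt hpos))

/-- **NH1 (one-sided Taylor, one real variable).** If `φ` is differentiable near `0` with derivative
`φ'`, `φ' 0 = 0`, `φ'` has derivative `a` at `0`, `φ 0 = ψ 0 = 0`, `ψ` is differentiable at `0` with
`ψ' 0 ≠ 0`, and `ψ < 0 ⇒ φ ≤ 0` near `0`, then `a ≤ 0` (else `φ > 0` on a punctured neighbourhood of
`0` by the mean value theorem, so `ψ ≥ 0 = ψ 0` near `0` and Fermat gives `ψ' 0 = 0`). -/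
theorem stub_nh_oneSidedTaylor : ∀ (φ φ' ψ : ℝ → ℝ) (a : ℝ), (∀ᶠ t in 𝓝 (0 : ℝ), HasDerivAt φ (φ' t) t) → HasDerivAt φ' a 0 → DifferentiableAt ℝ ψ 0 → (∀ᶠ t in 𝓝 (0 : ℝ), ψ t < 0 → φ t ≤ 0) → ψ 0 = 0 → φ 0 = 0 → deriv ψ 0 ≠ 0 → φ' 0 = 0 → a ≤ 0 := by
  intro φ φ' ψ a hφ hφ' _hψ himp hψ0 hφ0 hdψ hφ'0
  refine not_lt.mp ?_
  intro ha
  -- the difference quotient `φ' t / t` is positive on a punctured neighbourhood of `0`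
  have h1 : ∀ᶠ t in 𝓝[≠] (0 : ℝ), 0 < φ' t / t := by
    have hq := (hasDerivAt_iff_tendsto_slope.mp hφ').eventually_const_lt ha
    filter_upwards [hq] with t h
    simpa [slope_def_field, hφ'0] using h
  have h1' : ∀ᶠ t in 𝓝 (0 : ℝ), t ≠ 0 → 0 < φ' t / t := by
    filter_upwards [eventually_nhdsWithin_iff.mp h1] with t ht ht0
    exact ht (Set.mem_compl_singleton_iff.mpr ht0)
  -- a symmetric interval on which both local hypotheses hold pointwise
  obtain ⟨δ, hδ, hball⟩ := Metric.eventually_nhds_iff_ball.mp (hφ.and h1')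
  have hI : ∀ s ∈ Ioo (-δ) δ, HasDerivAt φ (φ' s) s ∧ (s ≠ 0 → 0 < φ' s / s) := by
    intro s hs
    refine hball s ?_
    rw [Real.ball_eq_Ioo, zero_sub, zero_add]
    exact hs
  -- hence `φ > 0` on a punctured neighbourhood of `0`
  have h2 : ∀ᶠ t in 𝓝 (0 : ℝ), t ≠ 0 → 0 < φ t := by
    filter_upwards [Ioo_mem_nhds (show -δ < (0 : ℝ) by linarith) hδ] with t ht ht0
    exact pos_of_hasDerivAt_of_div_pos (fun s hs => (hI s hs).1) (fun s hs => (hI s hs).2) hφ0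
      ht ht0
  -- so `ψ` cannot be negative near `0`: `0` is a local minimum of `ψ`
  have hmin : IsLocalMin ψ 0 := by
    show ∀ᶠ t in 𝓝 (0 : ℝ), ψ 0 ≤ ψ t
    filter_upwards [himp, h2] with t hti htp
    rw [hψ0]
    by_contra hle
    have hlt : ψ t < 0 := not_le.mp hle
    have ht0 : t ≠ 0 := by
      rintro rfl
      rw [hψ0] at hlt
      exact lt_irrefl _ hlt
    exact not_lt.mpr (hti hlt) (htp ht0)
  -- Fermat: `ψ' 0 = 0`, contradiction
  exact hdψ hmin.deriv_eq_zero

end Summit.FinalStateConjecture.FinalStateConjecture.Theorems.HawkingExtensionIsKerr.SketchIdeator2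

end
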